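import Summits.Ventures.PercRepro.ThetaSet

/-!
# Theorem Z: Conjecture V at the near-member `u = ∅`

An MS-excess-1 family `F` (`|F \\ F| = |F| + 1`) disjoint from its complement family, every member
of which is a difference or a co-difference (`t ∈ F \\ F` or `univ \ t ∈ F \\ F`), has ALL its
members among the differences or ALL their complements among the differences
(`forall_mem_diffs_or_forall_compl_mem_diffs`). This is Conjecture V* of
proofs/MINE1-theoremS.md at the degenerate near-member `u = ∅` (there «A-signable» reads
`univ \ t ∈ D` and «C*-signable» reads `t ∈ D`), and by Addendum 9 §7 of that dossier Conjecture V
is equivalent to the statement that every member of a residue instance is a difference or a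
co-difference.

Proof. With `∅, univ ∉ F` choose `ε t ∈ {t, univ \ t} ∩ D`; `ε` is injective on `F` (validity) and
misses `∅`, so `D = insert ∅ (F.image ε)` by cardinality. Hence no member has both `t` and
`univ \ t` in `D`; with `A := {t : univ \ t ∈ D}` and `C := {t : t ∈ D}` every difference is `∅`,
a `C`-member or the complement of an `A`-member. No member meets an `A`-member in `∅`, no member
covers a `C`-member up to `univ`; hence every `C`-member lies in every `A`-member, then every
`A`-member equals `W := ⋃ C` (else `C = {W}` and `W` could not be a difference), and finally
`univ \ W ∈ D` forces `W = univ` — absurd. So `A = ∅` or `C = ∅`.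
-/

namespace PercRepro.MSTight

open Finset
open scoped FinsetFamily

variable {α : Type*} [DecidableEq α] [Fintype α]

/-- Complementation in `univ` is injective. -/
theorem univ_sdiff_inj {s t : Finset α} (h : Finset.univ \ s = Finset.univ \ t) : s = t := by
  have := congrArg (fun x => Finset.univ \ x) h
  simpa [Finset.sdiff_sdiff_eq_self (subset_univ s), Finset.sdiff_sdiff_eq_self (subset_univ t)]
    using this

/-- **Theorem Z.** An MS-excess-1 family disjoint from its complement family in which every member
is a difference or a co-difference has all members among the differences, or all complements of
members among the differences. -/
theorem forall_mem_diffs_or_forall_compl_mem_diffs {F : Finset (Finset α)}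
    (hval : Disjoint F (compls F)) (hex : (F \\ F).card = F.card + 1)
    (hgood : ∀ t ∈ F, t ∈ F \\ F ∨ Finset.univ \ t ∈ F \\ F) :
    (∀ t ∈ F, t ∈ F \\ F) ∨ (∀ t ∈ F, Finset.univ \ t ∈ F \\ F) := by
  -- validity in elementwise form
  have hcomp : ∀ t ∈ F, Finset.univ \ t ∉ F := fun t ht h =>
    Finset.disjoint_left.1 hval ht (mem_compls.2 h)
  -- the degenerate members `∅` and `univ`
  by_cases h0F : (∅ : Finset α) ∈ F
  · left
    intro t ht
    exact mem_diffs.2 ⟨t, ht, ∅, h0F, Finset.sdiff_empty⟩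
  by_cases hUF : (Finset.univ : Finset α) ∈ F
  · right
    intro t ht
    exact mem_diffs.2 ⟨Finset.univ, hUF, t, ht, rfl⟩
  -- `F` is nonempty
  obtain ⟨t₀, ht₀⟩ : F.Nonempty := by
    by_contra hemp
    rw [not_nonempty_iff_eq_empty] at hemp
    subst hemp
    simp at hex
  have hD0 : (∅ : Finset α) ∈ F \\ F := mem_diffs.2 ⟨t₀, ht₀, t₀, ht₀, Finset.sdiff_self t₀⟩
  -- the signed copy `ε`
  set D := F \\ F with hDdef
  let ε : Finset α → Finset α := fun t => if t ∈ D then t else Finset.univ \ t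
  have hε : ∀ t ∈ F, ε t ∈ D := by
    intro t ht
    by_cases h : t ∈ D
    · simp [ε, h]
    · have := (hgood t ht).resolve_left h
      simpa [ε, h] using this
  have hεinj : Set.InjOn ε F := by
    intro s hs t ht hst
    simp only [ε] at hst
    by_cases h1 : s ∈ D <;> by_cases h2 : t ∈ D
    · simpa [h1, h2] using hst
    · rw [if_pos h1, if_neg h2] at hst
      exact absurd (hst ▸ hs) (hcomp t ht)
    · rw [if_neg h1, if_pos h2] at hst
      exact absurd (hst ▸ ht) (hcomp s hs)
    · rw [if_neg h1, if_neg h2] at hst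
      exact univ_sdiff_inj hst
  have hε0 : (∅ : Finset α) ∉ F.image ε := by
    intro h
    obtain ⟨t, ht, hte⟩ := mem_image.1 h
    simp only [ε] at hte
    by_cases h1 : t ∈ D
    · rw [if_pos h1] at hte
      exact h0F (hte ▸ ht)
    · rw [if_neg h1] at hte
      have : t = Finset.univ := by
        have hsub : Finset.univ ⊆ t := Finset.sdiff_eq_empty_iff_subset.1 hte
        exact Finset.eq_univ_of_forall fun x => hsub (mem_univ x)
      exact hUF (this ▸ ht)
  have hsub : insert ∅ (F.image ε) ⊆ D := by
    intro x hx
    rcases mem_insert.1 hx with rfl | hx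
    · exact hD0
    · obtain ⟨t, ht, rfl⟩ := mem_image.1 hx
      exact hε t ht
  have hDeq : D = insert ∅ (F.image ε) := by
    symm
    apply eq_of_subset_of_card_le hsub
    rw [card_insert_of_notMem hε0, card_image_of_injOn hεinj]
    omega
  -- membership in `D` through the signed copy
  have hmemD : ∀ x, x ∈ D → x = ∅ ∨ ∃ t ∈ F, ε t = x := by
    intro x hx
    rw [hDeq] at hx
    rcases mem_insert.1 hx with rfl | hx
    · exact Or.inl rfl
    · obtain ⟨t, ht, hte⟩ := mem_image.1 hx
      exact Or.inr ⟨t, ht, hte⟩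
  have hε_of_mem : ∀ t ∈ F, t ∈ D → ε t = t := fun t _ h => by simp [ε, h]
  have hε_of_not : ∀ t ∈ F, t ∉ D → ε t = Finset.univ \ t := fun t _ h => by simp [ε, h]
  -- no member has both `t` and `univ \ t` among the differences
  have hnoboth : ∀ t ∈ F, t ∈ D → Finset.univ \ t ∈ D → False := by
    intro t ht htD htcD
    rcases hmemD _ htcD with h | ⟨s, hs, hse⟩
    · apply hUF
      have hsub : Finset.univ ⊆ t := Finset.sdiff_eq_empty_iff_subset.1 h
      have : t = Finset.univ := Finset.eq_univ_of_forall fun x => hsub (mem_univ x)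
      exact this ▸ ht
    · by_cases hsD : s ∈ D
      · rw [hε_of_mem s hs hsD] at hse
        exact hcomp t ht (hse ▸ hs)
      · rw [hε_of_not s hs hsD] at hse
        have : s = t := univ_sdiff_inj hse
        exact hsD (this ▸ htD)
  -- every difference is `∅`, a `C`-member or the complement of an `A`-member
  have hdiff : ∀ x ∈ D, x = ∅ ∨ (∃ c ∈ F, c ∈ D ∧ x = c) ∨
      (∃ a ∈ F, a ∉ D ∧ x = Finset.univ \ a) := by
    intro x hx
    rcases hmemD x hx with h | ⟨t, ht, hte⟩
    · exact Or.inl h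
    · by_cases htD : t ∈ D
      · rw [hε_of_mem t ht htD] at hte
        exact Or.inr (Or.inl ⟨t, ht, htD, hte.symm⟩)
      · rw [hε_of_not t ht htD] at hte
        exact Or.inr (Or.inr ⟨t, ht, htD, hte.symm⟩)
  -- (F1) no member is disjoint from an `A`-member; (F2) no member covers a `C`-member to `univ`
  have hF1 : ∀ a ∈ F, a ∉ D → ∀ s ∈ F, ¬ Disjoint s a := by
    intro a ha haD s hs hdis
    apply haD
    refine mem_diffs.2 ⟨a, ha, s, hs, ?_⟩
    exact Finset.sdiff_eq_self_iff_disjoint.2 hdis.symm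
  have hF2 : ∀ c ∈ F, c ∈ D → ∀ s ∈ F, ¬ (Finset.univ \ c ⊆ s) := by
    intro c hc hcD s hs hcov
    apply hnoboth c hc hcD
    refine mem_diffs.2 ⟨s, hs, c, hc, ?_⟩
    ext x
    simp only [mem_sdiff, mem_univ, true_and]
    constructor
    · intro h; exact h.2
    · intro h; exact ⟨hcov (by simp [h]), h⟩
  -- (3) every `C`-member lies in every `A`-member
  have hCA : ∀ a ∈ F, a ∉ D → ∀ c ∈ F, c ∈ D → c ⊆ a := by
    intro a ha haD c hc hcD
    have hx : c \ a ∈ D := mem_diffs.2 ⟨c, hc, a, ha, rfl⟩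
    rcases hdiff _ hx with h | ⟨c', hc', _, hc'e⟩ | ⟨a', ha', _, ha'e⟩
    · exact Finset.sdiff_eq_empty_iff_subset.1 h
    · exfalso
      apply hF1 a ha haD c' hc'
      rw [← hc'e]
      exact Finset.sdiff_disjoint
    · exfalso
      apply hF2 c hc hcD a' ha'
      intro x hx
      by_contra hxa'
      have hx' : x ∈ Finset.univ \ a' := mem_sdiff.2 ⟨mem_univ x, hxa'⟩
      rw [← ha'e] at hx'
      exact (mem_sdiff.1 hx).2 (mem_sdiff.1 hx').1
  -- the union of the `C`-members
  set C := F.filter (fun t => t ∈ D) with hCdef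
  set W := C.sup id with hWdef
  have hcW : ∀ c ∈ F, c ∈ D → c ⊆ W := fun c hc hcD =>
    Finset.le_sup (f := id) (mem_filter.2 ⟨hc, hcD⟩)
  have hWa : ∀ a ∈ F, a ∉ D → W ⊆ a := by
    intro a ha haD
    apply Finset.sup_le
    intro c hc
    exact hCA a ha haD c (mem_filter.1 hc).1 (mem_filter.1 hc).2
  -- (4)–(6): the contradiction when both classes are nonempty
  by_cases hA : ∃ a ∈ F, a ∉ D
  · by_cases hC : ∃ c ∈ F, c ∈ D
    · exfalso
      obtain ⟨a₀, ha₀, ha₀D⟩ := hA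
      obtain ⟨c₀, hc₀, hc₀D⟩ := hC
      have hWne : W ≠ ∅ := by
        intro hW
        have : c₀ ⊆ (∅ : Finset α) := hW ▸ hcW c₀ hc₀ hc₀D
        exact h0F ((Finset.subset_empty.1 this) ▸ hc₀)
      -- (4) for `a ∈ A`, `c ∈ C`: `a \ c` is a `C`-member making `a = W`, or forces `c = W`
      have hstep : ∀ a ∈ F, a ∉ D → ∀ c ∈ F, c ∈ D → a = W ∨ c = W := by
        intro a ha haD c hc hcD
        have hx : a \ c ∈ D := mem_diffs.2 ⟨a, ha, c, hc, rfl⟩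
        rcases hdiff _ hx with h | ⟨c', hc', hc'D, hc'e⟩ | ⟨a', ha', ha'D, ha'e⟩
        · exfalso
          have h1 : a ⊆ c := Finset.sdiff_eq_empty_iff_subset.1 h
          have h2 : c ⊆ a := hCA a ha haD c hc hcD
          exact haD ((Finset.Subset.antisymm h2 h1) ▸ hcD)
        · left
          apply Finset.Subset.antisymm _ (hWa a ha haD)
          intro x hxa
          by_cases hxc : x ∈ c
          · exact hcW c hc hcD hxc
          · have : x ∈ c' := by rw [← hc'e]; exact mem_sdiff.2 ⟨hxa, hxc⟩
            exact hcW c' hc' hc'D this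
        · right
          apply Finset.Subset.antisymm (hcW c hc hcD)
          intro x hxW
          have hxa : x ∈ a := hWa a ha haD hxW
          have hxa' : x ∈ a' := hWa a' ha' ha'D hxW
          by_contra hxc
          have : x ∈ Finset.univ \ a' := by rw [← ha'e]; exact mem_sdiff.2 ⟨hxa, hxc⟩
          exact (mem_sdiff.1 this).2 hxa'
      -- (5) every `A`-member equals `W`
      have hAW : ∀ a ∈ F, a ∉ D → a = W := by
        intro a ha haD
        by_contra hne
        -- then every `C`-member is `W`, and `W ∈ D` is impossible
        have hCW : ∀ c ∈ F, c ∈ D → c = W := fun c hc hcD =>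
          (hstep a ha haD c hc hcD).resolve_left hne
        have hWF : W ∈ F := (hCW c₀ hc₀ hc₀D) ▸ hc₀
        have hWD : W ∈ D := (hCW c₀ hc₀ hc₀D) ▸ hc₀D
        obtain ⟨s, hs, s', hs', hss'⟩ := mem_diffs.1 hWD
        have hdis : Disjoint W s' := by rw [← hss']; exact Finset.sdiff_disjoint
        by_cases hs'D : s' ∈ D
        · have := hCW s' hs' hs'D
          subst this
          exact hWne ((Finset.disjoint_self_iff_empty _).1 hdis)
        · have hsub : W ⊆ s' := hWa s' hs' hs'D
          apply hWne
          exact (Finset.disjoint_self_iff_empty _).1 (Finset.disjoint_of_subset_right hsub hdis)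
      -- (6) `W ∈ A`, so `univ \ W ∈ D`, but every member lies in `W`
      have hWF : W ∈ F := (hAW a₀ ha₀ ha₀D) ▸ ha₀
      have hWnD : W ∉ D := (hAW a₀ ha₀ ha₀D) ▸ ha₀D
      have hWcD : Finset.univ \ W ∈ D := (hgood W hWF).resolve_left hWnD
      obtain ⟨s, hs, s', _, hss'⟩ := mem_diffs.1 hWcD
      have hsW : s ⊆ W := by
        by_cases hsD : s ∈ D
        · exact hcW s hs hsD
        · exact (hAW s hs hsD) ▸ Finset.Subset.refl _
      have hsub : Finset.univ \ W ⊆ W := by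
        rw [← hss']
        exact Finset.Subset.trans Finset.sdiff_subset hsW
      apply hUF
      have hW : Finset.univ \ W = ∅ := by
        apply Finset.eq_empty_of_forall_notMem
        intro x hx
        exact (mem_sdiff.1 hx).2 (hsub hx)
      have : W = Finset.univ :=
        Finset.eq_univ_of_forall fun x => (Finset.sdiff_eq_empty_iff_subset.1 hW) (mem_univ x)
      exact this ▸ hWF
    · -- no `C`-member: every member is an `A`-member
      right
      intro t ht
      exact (hgood t ht).resolve_left fun h => hC ⟨t, ht, h⟩
  · -- no `A`-member: every member is a difference
    left
    intro t ht
    by_contra h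
    exact hA ⟨t, ht, h⟩

end PercRepro.MSTight
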